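import Literature.NumberTheory.LFunctions.KloostermanFractionsAmplifier
import HarnessLib

/-!
# Bilinear forms with Kloosterman fractions: the amplified second moment `𝓒_b ≤ (2M/P²)(|𝓓| + |𝓞|)`

Topic `NumberTheory/LFunctions`.  S. Bettin, V. Chandee, *Trilinear forms with Kloosterman
fractions*, Adv. Math. 328 (2018), §2 (following Duke–Friedlander–Iwaniec, Invent. Math. 128
(1997)): after Cauchy–Schwarz one must bound
`𝓒_b = ∑_{m ∼ M, (m,b)=1} |∑_{n ∼ N', (n,m)=1} γ_n e(k m̄/(bn))|²` (`m̄` the inverse of `m` modulo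
`bn`); with the amplifier over a set `𝓛` and `P ≤ #{ℓ ∈ 𝓛 : (ℓ, m) = 1}`,
"`𝓒_b ≪ M L^{-2+ε} 𝓓_b`", and "squaring out and exploiting the orthogonality relation of character
sums, we obtain `𝓓_b = … = 𝓓_b + 𝓞_b`, where `𝓓_b` is the contribution from the diagonal terms
`ℓ₁n₁ = ℓ₂n₂`, and `𝓞_b` is the sum restricted to the off-diagonal terms `ℓ₁n₁ ≠ ℓ₂n₂`."

This file DEFINES these objects (real definitions, `kf` = "Kloosterman fractions") and PROVES the
step, for arbitrary `k, b ≥ 1, M, N', γ, 𝓛, P`: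

* `kfPhase k q m = e(k m̄^{(q)}/q)`, `kfCoeff k b γ m n = γ_n e(k m̄^{(bn)}/(bn))` (`c_m(n)`),
  `kfInner` (`X_m = ∑_{n ≤ 2N', (n,m)=1} c_m(n)`), `kfC` (`𝓒_b = ∑_{m ≤ 2M, (m,b)=1} |X_m|²`),
  `kfTerm`, `kfSigma` (the orthogonality expansion
  `Σ_m = ∑_{ℓ₁,n₁,ℓ₂,n₂ : (ℓ₂n₂,m)=1, ℓ₁n₁≡ℓ₂n₂ (m)} c_m(n₁) conj c_m(n₂)`), `kfDiag`, `kfOff`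
  (its parts `ℓ₁n₁ = ℓ₂n₂`, `ℓ₁n₁ ≠ ℓ₂n₂`);
* `kfSigma_eq_kfDiag_add_kfOff`; `kfSigma_eq_ofReal` (`φ(m) Σ_m = ∑_χ |A_χ|²|C_χ|²`, so `Σ_m` is
  real and `≥ 0`); `norm_kfInner_sq_le` (`|X_m|² ≤ φ(m) P⁻² Σ_m`);
* **`kfC_le_diag_add_off`**: if `0 < P ≤ #{ℓ ∈ 𝓛 : (ℓ,m)=1}` for every `m ≤ 2M` with `(m,b)=1`,
  then `𝓒_b ≤ (2M/P²) (‖∑_m kfDiag m‖ + ‖∑_m kfOff m‖)` (using `φ(m) ≤ m ≤ 2M` and `Σ_m ≥ 0`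
  BEFORE summing over `m`, as in the source).

## References

* S. Bettin, V. Chandee, Adv. Math. 328 (2018) 1234–1262 (arXiv:1502.00769), §2 (𝓒_b, 𝓓_b,
  the diagonal/off-diagonal split). [BettinChandee2018]
* W. Duke, J. Friedlander, H. Iwaniec, Invent. Math. 128 (1997) 23–43. [DukeFriedlanderIwaniec1997]
-/

noncomputable section

open Finset

namespace Literature.NumberTheory.LFunctions

/-- The Kloosterman-fraction phase `e(k m̄/q)` with `m̄` the inverse of `m` modulo `q`
(`((m : ZMod q)⁻¹).val`; `e(x) = exp(2πix)`). [cite: BettinChandee2018, §2] -/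
def kfPhase (k : ℤ) (q m : ℕ) : ℂ :=
  Complex.exp (2 * Real.pi * Complex.I * ((k : ℂ) * ((((m : ZMod q)⁻¹).val : ℕ) : ℂ) / (q : ℂ)))

/-- The coefficient `c_m(n) = γ_n e(k m̄/(bn))` (`m̄` modulo `bn`) of the inner sum of `𝓒_b`.
[cite: BettinChandee2018, §2] -/
def kfCoeff (k : ℤ) (b : ℕ) (γ : ℕ → ℂ) (m n : ℕ) : ℂ :=
  γ n * kfPhase k (b * n) m

/-- The inner sum `X_m = ∑_{1 ≤ n ≤ 2N', (n,m)=1} c_m(n)`. [cite: BettinChandee2018, §2] -/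
def kfInner (k : ℤ) (b : ℕ) (N' : ℝ) (γ : ℕ → ℂ) (m : ℕ) : ℂ :=
  ∑ n ∈ (Icc 1 ⌊2 * N'⌋₊).filter (fun n => n.Coprime m), kfCoeff k b γ m n

/-- `𝓒_b(M, N'; γ) = ∑_{1 ≤ m ≤ 2M, (m,b)=1} |X_m|²`. [cite: BettinChandee2018, §2] -/
def kfC (k : ℤ) (b : ℕ) (M N' : ℝ) (γ : ℕ → ℂ) : ℝ :=
  ∑ m ∈ (Icc 1 ⌊2 * M⌋₊).filter (fun m => m.Coprime b), ‖kfInner k b N' γ m‖ ^ 2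

/-- One term of the orthogonality expansion:
`[(ℓ₂n₂, m) = 1, ℓ₁n₁ ≡ ℓ₂n₂ (mod m)] c_m(n₁) conj(c_m(n₂))`. [cite: BettinChandee2018, §2] -/
def kfTerm (k : ℤ) (b : ℕ) (γ : ℕ → ℂ) (m ℓ₁ n₁ ℓ₂ n₂ : ℕ) : ℂ :=
  if (ℓ₂ * n₂).Coprime m ∧ ((ℓ₁ * n₁ : ℕ) : ZMod m) = ((ℓ₂ * n₂ : ℕ) : ZMod m) then
    kfCoeff k b γ m n₁ * (starRingEnd ℂ) (kfCoeff k b γ m n₂) else 0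

/-- `Σ_m = ∑_{ℓ₁∈𝓛} ∑_{n₁ ≤ 2N'} ∑_{ℓ₂∈𝓛} ∑_{n₂ ≤ 2N'} kfTerm` (so that `𝓓_b = ∑_m Σ_m`).
[cite: BettinChandee2018, §2] -/
def kfSigma (k : ℤ) (b : ℕ) (N' : ℝ) (γ : ℕ → ℂ) (𝓛 : Finset ℕ) (m : ℕ) : ℂ :=
  ∑ ℓ₁ ∈ 𝓛, ∑ n₁ ∈ Icc 1 ⌊2 * N'⌋₊, ∑ ℓ₂ ∈ 𝓛, ∑ n₂ ∈ Icc 1 ⌊2 * N'⌋₊, kfTerm k b γ m ℓ₁ n₁ ℓ₂ n₂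

/-- The diagonal part `ℓ₁n₁ = ℓ₂n₂` of `Σ_m`. [cite: BettinChandee2018, §2] -/
def kfDiag (k : ℤ) (b : ℕ) (N' : ℝ) (γ : ℕ → ℂ) (𝓛 : Finset ℕ) (m : ℕ) : ℂ :=
  ∑ ℓ₁ ∈ 𝓛, ∑ n₁ ∈ Icc 1 ⌊2 * N'⌋₊, ∑ ℓ₂ ∈ 𝓛, ∑ n₂ ∈ Icc 1 ⌊2 * N'⌋₊,
    if ℓ₁ * n₁ = ℓ₂ * n₂ then kfTerm k b γ m ℓ₁ n₁ ℓ₂ n₂ else 0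

/-- The off-diagonal part `ℓ₁n₁ ≠ ℓ₂n₂` of `Σ_m`. [cite: BettinChandee2018, §2] -/
def kfOff (k : ℤ) (b : ℕ) (N' : ℝ) (γ : ℕ → ℂ) (𝓛 : Finset ℕ) (m : ℕ) : ℂ :=
  ∑ ℓ₁ ∈ 𝓛, ∑ n₁ ∈ Icc 1 ⌊2 * N'⌋₊, ∑ ℓ₂ ∈ 𝓛, ∑ n₂ ∈ Icc 1 ⌊2 * N'⌋₊,
    if ℓ₁ * n₁ = ℓ₂ * n₂ then 0 else kfTerm k b γ m ℓ₁ n₁ ℓ₂ n₂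

/-- `Σ_m = (diagonal) + (off-diagonal)`. [cite: BettinChandee2018, §2] -/
theorem kfSigma_eq_kfDiag_add_kfOff (k : ℤ) (b : ℕ) (N' : ℝ) (γ : ℕ → ℂ) (𝓛 : Finset ℕ) (m : ℕ) :
    kfSigma k b N' γ 𝓛 m = kfDiag k b N' γ 𝓛 m + kfOff k b N' γ 𝓛 m := by
  unfold kfSigma kfDiag kfOff
  rw [← Finset.sum_add_distrib]
  refine Finset.sum_congr rfl fun ℓ₁ _ => ?_
  rw [← Finset.sum_add_distrib]
  refine Finset.sum_congr rfl fun n₁ _ => ?_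
  rw [← Finset.sum_add_distrib]
  refine Finset.sum_congr rfl fun ℓ₂ _ => ?_
  rw [← Finset.sum_add_distrib]
  refine Finset.sum_congr rfl fun n₂ _ => ?_
  split_ifs <;> simp

/-- **Orthogonality**: `φ(m) Σ_m = ∑_χ |∑_{ℓ∈𝓛} χ(ℓ)|² |∑_{n ≤ 2N'} c_m(n) χ(n)|²`; in particular
`Σ_m` is a nonnegative real. [cite: BettinChandee2018, §2] -/
theorem kfSigma_eq_ofReal (k : ℤ) (b : ℕ) (N' : ℝ) (γ : ℕ → ℂ) (𝓛 : Finset ℕ) (m : ℕ)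
    [NeZero m] :
    ((m.totient : ℂ)) * kfSigma k b N' γ 𝓛 m =
      ∑ χ : DirichletCharacter ℂ m, (((‖∑ ℓ ∈ 𝓛, (1 : ℂ) * χ (ℓ : ZMod m)‖ ^ 2 *
        ‖∑ n ∈ Icc 1 ⌊2 * N'⌋₊, kfCoeff k b γ m n * χ (n : ZMod m)‖ ^ 2 : ℝ)) : ℂ) := by
  rw [DFI_amplifier_orthogonality m 𝓛 (Icc 1 ⌊2 * N'⌋₊) (fun _ => (1 : ℂ)) (kfCoeff k b γ m)]
  unfold kfSigma kfTerm
  simp only [one_mul]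

/-- `Σ_m` is real and nonnegative: `Σ_m = ↑((Σ_m).re)` and `0 ≤ (Σ_m).re`. [folklore] -/
theorem kfSigma_re_nonneg (k : ℤ) (b : ℕ) (N' : ℝ) (γ : ℕ → ℂ) (𝓛 : Finset ℕ) {m : ℕ}
    (hm : 0 < m) :
    (kfSigma k b N' γ 𝓛 m : ℂ) = ((kfSigma k b N' γ 𝓛 m).re : ℂ) ∧
      0 ≤ (kfSigma k b N' γ 𝓛 m).re := by
  haveI : NeZero m := ⟨hm.ne'⟩
  have h := kfSigma_eq_ofReal k b N' γ 𝓛 m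
  have hφ : (0 : ℝ) < m.totient := by exact_mod_cast Nat.totient_pos.mpr hm
  have hφC : (m.totient : ℂ) ≠ 0 := by exact_mod_cast hφ.ne'
  set R : ℝ := ∑ χ : DirichletCharacter ℂ m, ‖∑ ℓ ∈ 𝓛, (1 : ℂ) * χ (ℓ : ZMod m)‖ ^ 2 *
    ‖∑ n ∈ Icc 1 ⌊2 * N'⌋₊, kfCoeff k b γ m n * χ (n : ZMod m)‖ ^ 2 with hR
  have hR0 : 0 ≤ R := Finset.sum_nonneg fun _ _ => by positivity
  have hS : kfSigma k b N' γ 𝓛 m = ((R / m.totient : ℝ) : ℂ) := by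
    have hR' : (R : ℂ) = (m.totient : ℂ) * kfSigma k b N' γ 𝓛 m := by
      rw [hR, Complex.ofReal_sum]
      exact h.symm
    push_cast
    rw [hR']
    field_simp
  constructor
  · rw [hS, Complex.ofReal_re]
  · rw [hS, Complex.ofReal_re]; positivity

/-- **`|X_m|² ≤ φ(m) P⁻² Σ_m`** for `0 < P ≤ #{ℓ ∈ 𝓛 : (ℓ, m) = 1}` (the amplifier bound).
[cite: BettinChandee2018, §2] -/
theorem norm_kfInner_sq_le (k : ℤ) (b : ℕ) (N' : ℝ) (γ : ℕ → ℂ) (𝓛 : Finset ℕ) {m : ℕ}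
    (hm : 0 < m) {P : ℝ} (hP : 0 < P)
    (hP𝓛 : P ≤ ((𝓛.filter (fun ℓ => ℓ.Coprime m)).card : ℝ)) :
    ‖kfInner k b N' γ m‖ ^ 2 ≤ (m.totient : ℝ) / P ^ 2 * (kfSigma k b N' γ 𝓛 m).re := by
  haveI : NeZero m := ⟨hm.ne'⟩
  have h := DFI_amplifier_bound_of_le_card m 𝓛 (Icc 1 ⌊2 * N'⌋₊) (kfCoeff k b γ m) hP hP𝓛
  have hS : (∑ ℓ₁ ∈ 𝓛, ∑ n₁ ∈ Icc 1 ⌊2 * N'⌋₊, ∑ ℓ₂ ∈ 𝓛, ∑ n₂ ∈ Icc 1 ⌊2 * N'⌋₊,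
      if (ℓ₂ * n₂).Coprime m ∧ ((ℓ₁ * n₁ : ℕ) : ZMod m) = ((ℓ₂ * n₂ : ℕ) : ZMod m) then
        kfCoeff k b γ m n₁ * (starRingEnd ℂ) (kfCoeff k b γ m n₂) else 0) =
      kfSigma k b N' γ 𝓛 m := rfl
  rw [hS] at h
  have hre := kfSigma_re_nonneg k b N' γ 𝓛 hm
  have hnorm : ‖kfSigma k b N' γ 𝓛 m‖ = (kfSigma k b N' γ 𝓛 m).re := by
    rw [hre.1, Complex.norm_real, Real.norm_of_nonneg hre.2, Complex.ofReal_re]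
  unfold kfInner
  rw [← hnorm]
  exact h

/-- **The amplified second moment**: if `0 < P ≤ #{ℓ ∈ 𝓛 : (ℓ, m) = 1}` for every
`1 ≤ m ≤ 2M` with `(m, b) = 1`, then
`𝓒_b ≤ (2M/P²) (‖∑_{m ≤ 2M,(m,b)=1} kfDiag m‖ + ‖∑_{m ≤ 2M,(m,b)=1} kfOff m‖)`.
[cite: BettinChandee2018, §2] -/
theorem kfC_le_diag_add_off (k : ℤ) (b : ℕ) (M N' : ℝ) (hM : 0 ≤ M) (γ : ℕ → ℂ)
    (𝓛 : Finset ℕ) {P : ℝ} (hP : 0 < P)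
    (hP𝓛 : ∀ m ∈ (Icc 1 ⌊2 * M⌋₊).filter (fun m => m.Coprime b),
      P ≤ ((𝓛.filter (fun ℓ => ℓ.Coprime m)).card : ℝ)) :
    kfC k b M N' γ ≤ 2 * M / P ^ 2 *
      (‖∑ m ∈ (Icc 1 ⌊2 * M⌋₊).filter (fun m => m.Coprime b), kfDiag k b N' γ 𝓛 m‖ +
        ‖∑ m ∈ (Icc 1 ⌊2 * M⌋₊).filter (fun m => m.Coprime b), kfOff k b N' γ 𝓛 m‖) := by
  unfold kfC
  -- termwise: `|X_m|² ≤ (2M/P²) (Σ_m).re`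
  have hterm : ∀ m ∈ (Icc 1 ⌊2 * M⌋₊).filter (fun m => m.Coprime b),
      ‖kfInner k b N' γ m‖ ^ 2 ≤ 2 * M / P ^ 2 * (kfSigma k b N' γ 𝓛 m).re := by
    intro m hm
    have hm' := Finset.mem_filter.mp hm
    have hm1 : 1 ≤ m := (Finset.mem_Icc.mp hm'.1).1
    have hm2 : m ≤ ⌊2 * M⌋₊ := (Finset.mem_Icc.mp hm'.1).2
    have hm0 : 0 < m := hm1
    have h1 := norm_kfInner_sq_le k b N' γ 𝓛 hm0 hP (hP𝓛 m hm)
    have hre := (kfSigma_re_nonneg k b N' γ 𝓛 hm0).2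
    have hφ : (m.totient : ℝ) ≤ 2 * M := by
      calc (m.totient : ℝ) ≤ m := by exact_mod_cast Nat.totient_le m
        _ ≤ ⌊2 * M⌋₊ := by exact_mod_cast hm2
        _ ≤ 2 * M := Nat.floor_le (by positivity)
    calc ‖kfInner k b N' γ m‖ ^ 2 ≤ (m.totient : ℝ) / P ^ 2 * (kfSigma k b N' γ 𝓛 m).re := h1
      _ ≤ 2 * M / P ^ 2 * (kfSigma k b N' γ 𝓛 m).re := by gcongr
  refine (Finset.sum_le_sum hterm).trans ?_
  rw [← Finset.mul_sum]
  have h2M : 0 ≤ 2 * M / P ^ 2 := by positivity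
  refine mul_le_mul_of_nonneg_left ?_ h2M
  -- `∑ (Σ_m).re = (∑ kfDiag + ∑ kfOff).re ≤ ‖∑ kfDiag‖ + ‖∑ kfOff‖`
  rw [← Complex.re_sum]
  simp_rw [kfSigma_eq_kfDiag_add_kfOff]
  rw [Finset.sum_add_distrib, Complex.add_re]
  exact add_le_add (Complex.re_le_norm _) (Complex.re_le_norm _)

end Literature.NumberTheory.LFunctions

end
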